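import Summits.CriticalPhenomena.PercolationContinuityZ3.Theorems.Transplant.PlanarSkeletonFrmCylKit
import HarnessLib

/-!
# Φ2 at the interface level, XII: ESCAPE DATA (finite classes + disjoint escapes) — the multi-type interface of the column method — and RING WALKS

builds on p205010 (kernel theorem, internal audit signed; external expert review pending) — nothing in this file uses p205010; nothing
here is a claim about any open node.
Lane `prim-bschramm`, seat `prim-bschramm-p4` gen 14 (PART C3 of `P4-GENERAL.md`, §36.7: the exact reach (★) of the column method).  Helper file
(`--supports stmt-CriticalPhenomena-4575 --as helper`).  No probability.

The one-type proof of Φ2 (files I–V) uses the type hypothesis only to build COLUMN CLASSES (finite apex fibres) with DISJOINT ESCAPES (up-thread of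
`x`, down-thread of `y`).  This file isolates exactly that input, for ANY number of types:
* **`EscData Φ t ℓ`**: a class label `cls : V → V` whose fibres in the big cylinder `C_{ℓ+3}(t)` lie in balls of radius `R₀` (so the classes are
  finite), and for every edge `{x, y}` inside `Λ_ℓ` two vertex-disjoint paths of length `≤ R₁` from `x` resp. `y`, inside their classes and
  inside `Λ_{ℓ+2}`, ending OUTSIDE `Λ_ℓ` — e.g. the branches of a finite-component spanning forest in which inside vertices are internal (★);
* ring walks for the enhancement run of the kits (sequel XIII): one step from `Λ_{ℓ+2} ∖ Λ_ℓ` onto the ring `‖φ − φ t‖_∞ = ℓ+2`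
  (`exists_walk_to_ring`) and along the ring to a vertex over the north-east corner (`exists_ring_to_corner`).
Sequels: XIII (the kits from escape data), XIV (`cylSubcritical_criticalProb_of_escData`: Φ2 at `p_c` from escape data at every width).
[cite: AizenmanGrimmett1991, Thm 1 (essential enhancements)] [cite: KozmaNitzan2024, §4 p. 15 (boxes and their translates); p. 26 ((29))]
-/

noncomputable section

namespace Summit.CriticalPhenomena.PercolationContinuityZ3.Theorems.Transplant

namespace PlanarSkeletonFrm

open SimpleGraph Walk Literature.Probability.LatticeModels
open Literature.Barriers.CriticalPhenomena (graphBall graphBall_finite)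
open scoped Classical

variable {V : Type} {G : SimpleGraph V} [G.LocallyFinite] (Φ : PlanarSkeletonFrm G)

/-! ## §1 Escape data -/

/-- **ESCAPE DATA at base `t`, level `ℓ`** (the multi-type input of the column method): finite classes in the big cylinder and, for every edge inside
the small cylinder, two vertex-disjoint in-class escapes to `Λ_{ℓ+2} ∖ Λ_ℓ` of bounded length. [cite: AizenmanGrimmett1991, Thm 1 (essential enhancements)] -/
structure EscData (t : V) (ℓ : ℕ) where
  /-- the class label -/
  cls : V → V
  /-- radius of the classes -/
  R₀ : ℕ
  /-- every big-cylinder vertex is within `R₀` of its class label (so classes are finite) -/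
  cls_ball : ∀ z : V, z ∈ Φ.cyl t (ℓ + 3) → z ∈ graphBall G (cls z) R₀
  /-- length bound of the escapes -/
  R₁ : ℕ
  /-- **the escapes** of an edge inside `Λ_ℓ` -/
  esc : ∀ x y : V, G.Adj x y → Φ.φ x - Φ.φ t ∈ box 2 ℓ → Φ.φ y - Φ.φ t ∈ box 2 ℓ →
    ∃ (p q : V) (A : G.Walk x p) (B : G.Walk y q), A.IsPath ∧ B.IsPath ∧ A.length ≤ R₁ ∧ B.length ≤ R₁ ∧
      (∀ w, w ∈ A.support → w ∈ B.support → False) ∧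
      (∀ w ∈ A.support, cls w = cls x ∧ Φ.φ w - Φ.φ t ∈ box 2 (ℓ + 2)) ∧
      (∀ w ∈ B.support, cls w = cls y ∧ Φ.φ w - Φ.φ t ∈ box 2 (ℓ + 2)) ∧
      Φ.φ p - Φ.φ t ∉ box 2 ℓ ∧ Φ.φ q - Φ.φ t ∉ box 2 ℓ

/-! ## §2 Ring walks -/

/-- **One step onto the ring**: from a vertex of `Λ_{ℓ+2} ∖ Λ_ℓ` a walk of length `≤ 1`, outside `Λ_ℓ` and inside `Λ_{ℓ+2}`, to a vertex with
`‖φ − φ t‖_∞ = ℓ+2`. [cite: KozmaNitzan2024, §4 p. 26 ((29))] -/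
theorem exists_walk_to_ring (t p : V) (ℓ : ℕ) (hin : Φ.φ p - Φ.φ t ∈ box 2 (ℓ + 2)) (hout : Φ.φ p - Φ.φ t ∉ box 2 ℓ) :
    ∃ r, ∃ W : G.Walk p r, W.length ≤ 1 ∧ Φ.φ r - Φ.φ t ∈ box 2 (ℓ + 2) ∧
      (|Φ.φ r 0 - Φ.φ t 0| = (ℓ : ℤ) + 2 ∨ |Φ.φ r 1 - Φ.φ t 1| = (ℓ : ℤ) + 2) ∧
      ∀ u ∈ W.support, Φ.φ u - Φ.φ t ∈ box 2 (ℓ + 2) ∧ Φ.φ u - Φ.φ t ∉ box 2 ℓ := by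
  have hin2 := mem_box_two.1 hin
  simp only [Pi.sub_apply] at hin2
  obtain ⟨h0, h1⟩ := hin2
  -- already on the ring?
  by_cases hring : |Φ.φ p 0 - Φ.φ t 0| = (ℓ : ℤ) + 2 ∨ |Φ.φ p 1 - Φ.φ t 1| = (ℓ : ℤ) + 2
  · refine ⟨p, Walk.nil, by simp, hin, hring, fun u hu => ?_⟩
    rw [Walk.support_nil, List.mem_singleton] at hu; subst hu; exact ⟨hin, hout⟩
  · -- some coordinate `i` has `|ρ_i| = ℓ+1`; step outward along it
    have hout' : ¬ (|Φ.φ p 0 - Φ.φ t 0| ≤ (ℓ : ℤ) ∧ |Φ.φ p 1 - Φ.φ t 1| ≤ (ℓ : ℤ)) := by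
      intro h; apply hout; rw [mem_box_two]; simpa only [Pi.sub_apply] using h
    rw [not_or] at hring
    have hex : ∃ i : Fin 2, |Φ.φ p i - Φ.φ t i| = (ℓ : ℤ) + 1 := by
      by_cases ha : |Φ.φ p 0 - Φ.φ t 0| ≤ (ℓ : ℤ)
      · refine ⟨1, ?_⟩
        have hb : ¬ |Φ.φ p 1 - Φ.φ t 1| ≤ (ℓ : ℤ) := fun h' => hout' ⟨ha, h'⟩
        have := hring.2
        omega
      · refine ⟨0, ?_⟩
        have := hring.1
        omega
    obtain ⟨i, hi⟩ := hex
    set σ : ℤˣ := if 0 ≤ Φ.φ p i - Φ.φ t i then 1 else -1 with hσ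
    obtain ⟨r, hadj, hφ⟩ := Φ.step p i σ
    have hri : Φ.φ r i - Φ.φ t i = (Φ.φ p i - Φ.φ t i) + (σ : ℤ) := by rw [hφ, Pi.add_apply, Pi.single_eq_same]; ring
    have hrj : ∀ j, j ≠ i → Φ.φ r j - Φ.φ t j = Φ.φ p j - Φ.φ t j := fun j hj => by
      rw [hφ, Pi.add_apply, Pi.single_eq_of_ne hj, add_zero]
    have hσv : ((σ : ℤˣ) : ℤ) = 1 ∨ ((σ : ℤˣ) : ℤ) = -1 := by
      rw [hσ]; split_ifs <;> simp
    have habs : |Φ.φ r i - Φ.φ t i| = (ℓ : ℤ) + 2 := by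
      rw [hri, hσ]
      split_ifs with hnn
      · rw [Units.val_one, abs_of_nonneg (by omega)]; rw [abs_of_nonneg hnn] at hi; omega
      · have hlt := not_le.1 hnn
        rw [Units.val_neg, Units.val_one, abs_of_neg (by omega)]
        rw [abs_of_neg hlt] at hi; omega
    have hrbox : Φ.φ r - Φ.φ t ∈ box 2 (ℓ + 2) := by
      rw [mem_box]
      intro j
      by_cases hj : j = i
      · subst hj; have := habs; rw [abs_eq (by positivity : (0:ℤ) ≤ (ℓ:ℤ)+2)] at this
        simp only [Pi.sub_apply]; push_cast; omega
      · rw [Pi.sub_apply, hrj j hj]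
        have := (mem_box.1 hin) j; simpa only [Pi.sub_apply] using this
    have hrout : Φ.φ r - Φ.φ t ∉ box 2 ℓ := by
      intro h
      have := (mem_box.1 h) i
      simp only [Pi.sub_apply] at this
      rw [abs_eq (by positivity : (0:ℤ) ≤ (ℓ:ℤ)+2)] at habs
      omega
    refine ⟨r, Walk.cons hadj Walk.nil, by simp, hrbox, ?_, fun u hu => ?_⟩
    · fin_cases i
      · exact Or.inl habs
      · exact Or.inr habs
    · rw [Walk.support_cons, Walk.support_nil, List.mem_cons, List.mem_singleton] at hu
      rcases hu with rfl | rfl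
      · exact ⟨hin, hout⟩
      · exact ⟨hrbox, hrout⟩

/-- A ray along the ring: if the fixed coordinate sits at `±(ℓ+2)` and the moving one stays in `[−(ℓ+2), ℓ+2]`, every vertex is on the ring.
Packaging of `exists_ray` in direction `e₁` with `φ₀ − φ₀ t = ±(ℓ+2)`. [folklore] -/
theorem exists_ring_ray_one (t v : V) (ℓ : ℕ) (σ : ℤˣ) (k : ℕ) (hv0 : |Φ.φ v 0 - Φ.φ t 0| = (ℓ : ℤ) + 2)
    (hv1 : |Φ.φ v 1 - Φ.φ t 1| ≤ (ℓ : ℤ) + 2) (hk : |Φ.φ v 1 - Φ.φ t 1 + k * (σ : ℤ)| ≤ (ℓ : ℤ) + 2) :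
    ∃ v', ∃ W : G.Walk v v', W.length = k ∧ Φ.φ v' 0 = Φ.φ v 0 ∧ Φ.φ v' 1 = Φ.φ v 1 + k * (σ : ℤ) ∧
      ∀ u ∈ W.support, Φ.φ u - Φ.φ t ∈ box 2 (ℓ + 2) ∧ (|Φ.φ u 0 - Φ.φ t 0| = (ℓ : ℤ) + 2 ∨ |Φ.φ u 1 - Φ.φ t 1| = (ℓ : ℤ) + 2) := by
  obtain ⟨v', W, hlen, hφ, hsup⟩ := Φ.exists_ray v 1 σ k
  have hc := Φ.ray_coords_one hφ
  refine ⟨v', W, hlen, hc.1, hc.2, fun u hu => ?_⟩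
  obtain ⟨j, hj, hju⟩ := hsup u hu
  have hcu := Φ.ray_coords_one hju
  have hσ : ((σ : ℤˣ) : ℤ) = 1 ∨ ((σ : ℤˣ) : ℤ) = -1 := by
    rcases Int.units_eq_one_or σ with h | h <;> simp [h]
  have hj' : (j : ℤ) ≤ k := by exact_mod_cast hj
  refine ⟨mem_box_two.2 ⟨?_, ?_⟩, Or.inl (by rw [hcu.1]; exact hv0)⟩
  · simp only [Pi.sub_apply]; rw [hcu.1]; push_cast; exact hv0.le
  · simp only [Pi.sub_apply]; rw [hcu.2]
    rw [abs_le] at hv1 hk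
    rw [abs_le]; push_cast
    rcases hσ with h | h <;> rw [h] at hk ⊢ <;> constructor <;> omega

/-- The same in direction `e₀` with `φ₁ − φ₁ t = ±(ℓ+2)`. [folklore] -/
theorem exists_ring_ray_zero (t v : V) (ℓ : ℕ) (σ : ℤˣ) (k : ℕ) (hv1 : |Φ.φ v 1 - Φ.φ t 1| = (ℓ : ℤ) + 2)
    (hv0 : |Φ.φ v 0 - Φ.φ t 0| ≤ (ℓ : ℤ) + 2) (hk : |Φ.φ v 0 - Φ.φ t 0 + k * (σ : ℤ)| ≤ (ℓ : ℤ) + 2) :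
    ∃ v', ∃ W : G.Walk v v', W.length = k ∧ Φ.φ v' 1 = Φ.φ v 1 ∧ Φ.φ v' 0 = Φ.φ v 0 + k * (σ : ℤ) ∧
      ∀ u ∈ W.support, Φ.φ u - Φ.φ t ∈ box 2 (ℓ + 2) ∧ (|Φ.φ u 0 - Φ.φ t 0| = (ℓ : ℤ) + 2 ∨ |Φ.φ u 1 - Φ.φ t 1| = (ℓ : ℤ) + 2) := by
  obtain ⟨v', W, hlen, hφ, hsup⟩ := Φ.exists_ray v 0 σ k
  have hc := Φ.ray_coords_zero hφ
  refine ⟨v', W, hlen, hc.2, hc.1, fun u hu => ?_⟩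
  obtain ⟨j, hj, hju⟩ := hsup u hu
  have hcu := Φ.ray_coords_zero hju
  have hσ : ((σ : ℤˣ) : ℤ) = 1 ∨ ((σ : ℤˣ) : ℤ) = -1 := by
    rcases Int.units_eq_one_or σ with h | h <;> simp [h]
  have hj' : (j : ℤ) ≤ k := by exact_mod_cast hj
  refine ⟨mem_box_two.2 ⟨?_, ?_⟩, Or.inr (by rw [hcu.2]; exact hv1)⟩
  · simp only [Pi.sub_apply]; rw [hcu.1]
    rw [abs_le] at hv0 hk
    rw [abs_le]; push_cast
    rcases hσ with h | h <;> rw [h] at hk ⊢ <;> constructor <;> omega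
  · simp only [Pi.sub_apply]; rw [hcu.2]; push_cast; exact hv1.le

/-- **Along the ring to the north-east corner**: from a ring vertex a walk of length `≤ 8ℓ+16` on the ring to a vertex `c` with
`φ c − φ t = (ℓ+2, ℓ+2)`. [cite: KozmaNitzan2024, §4 p. 26 ((29))] -/
theorem exists_ring_to_corner (t r : V) (ℓ : ℕ) (hr : Φ.φ r - Φ.φ t ∈ box 2 (ℓ + 2))
    (hring : |Φ.φ r 0 - Φ.φ t 0| = (ℓ : ℤ) + 2 ∨ |Φ.φ r 1 - Φ.φ t 1| = (ℓ : ℤ) + 2) :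
    ∃ c, ∃ W : G.Walk r c, Φ.φ c 0 - Φ.φ t 0 = (ℓ : ℤ) + 2 ∧ Φ.φ c 1 - Φ.φ t 1 = (ℓ : ℤ) + 2 ∧ W.length ≤ 8 * ℓ + 16 ∧
      ∀ u ∈ W.support, Φ.φ u - Φ.φ t ∈ box 2 (ℓ + 2) ∧ (|Φ.φ u 0 - Φ.φ t 0| = (ℓ : ℤ) + 2 ∨ |Φ.φ u 1 - Φ.φ t 1| = (ℓ : ℤ) + 2) := by
  have hr2 := mem_box_two.1 hr
  simp only [Pi.sub_apply] at hr2
  obtain ⟨h0, h1⟩ := hr2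
  have h0' := h0; have h1' := h1
  rw [abs_le] at h0' h1'
  rcases hring with he | hn
  · rw [abs_eq (by positivity : (0:ℤ) ≤ (ℓ:ℤ)+2)] at he
    rcases he with he | hw
    · -- EAST side: go north
      obtain ⟨c, W, hlen, hc0, hc1, hsup⟩ := Φ.exists_ring_ray_one t r ℓ 1 ((ℓ : ℤ) + 2 - (Φ.φ r 1 - Φ.φ t 1)).toNat
        (by rw [he]; exact abs_of_nonneg (by positivity)) h1
        (by rw [Units.val_one, mul_one, Int.toNat_of_nonneg (by omega)]; rw [abs_le]; constructor <;> omega)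
      refine ⟨c, W, by rw [hc0]; exact he, ?_, by rw [hlen]; omega, hsup⟩
      rw [hc1, Units.val_one, mul_one, Int.toNat_of_nonneg (by omega)]; omega
    · -- WEST side: go north to the NW corner, then east along the top
      obtain ⟨c₁, W₁, hlen₁, hc0, hc1, hsup₁⟩ := Φ.exists_ring_ray_one t r ℓ 1 ((ℓ : ℤ) + 2 - (Φ.φ r 1 - Φ.φ t 1)).toNat
        (by rw [hw]; rw [abs_of_nonpos (by omega)]; ring) h1
        (by rw [Units.val_one, mul_one, Int.toNat_of_nonneg (by omega)]; rw [abs_le]; constructor <;> omega)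
      have hc1' : Φ.φ c₁ 1 - Φ.φ t 1 = (ℓ : ℤ) + 2 := by
        rw [hc1, Units.val_one, mul_one, Int.toNat_of_nonneg (by omega)]; omega
      obtain ⟨c, W₂, hlen₂, hd1, hd0, hsup₂⟩ := Φ.exists_ring_ray_zero t c₁ ℓ 1 (2 * ℓ + 4)
        (by rw [hc1']; exact abs_of_nonneg (by positivity)) (by rw [hc0, hw, abs_of_nonpos (by omega)]; omega)
        (by rw [hc0, Units.val_one, mul_one]; push_cast; rw [abs_le]; constructor <;> omega)
      refine ⟨c, W₁.append W₂, ?_, by rw [hd1]; exact hc1', ?_, fun u hu => ?_⟩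
      · rw [hd0, hc0, Units.val_one, mul_one]; push_cast; omega
      · rw [Walk.length_append, hlen₁, hlen₂]; omega
      · rw [Walk.mem_support_append_iff] at hu
        rcases hu with hu | hu
        · exact hsup₁ u hu
        · exact hsup₂ u hu
  · rw [abs_eq (by positivity : (0:ℤ) ≤ (ℓ:ℤ)+2)] at hn
    rcases hn with hn | hs
    · -- NORTH side: go east
      obtain ⟨c, W, hlen, hc1, hc0, hsup⟩ := Φ.exists_ring_ray_zero t r ℓ 1 ((ℓ : ℤ) + 2 - (Φ.φ r 0 - Φ.φ t 0)).toNat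
        (by rw [hn]; exact abs_of_nonneg (by positivity)) h0
        (by rw [Units.val_one, mul_one, Int.toNat_of_nonneg (by omega)]; rw [abs_le]; constructor <;> omega)
      refine ⟨c, W, ?_, by rw [hc1]; exact hn, by rw [hlen]; omega, hsup⟩
      rw [hc0, Units.val_one, mul_one, Int.toNat_of_nonneg (by omega)]; omega
    · -- SOUTH side: go east to the SE corner, then north along the east side
      obtain ⟨c₁, W₁, hlen₁, hc1, hc0, hsup₁⟩ := Φ.exists_ring_ray_zero t r ℓ 1 ((ℓ : ℤ) + 2 - (Φ.φ r 0 - Φ.φ t 0)).toNat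
        (by rw [hs]; rw [abs_of_nonpos (by omega)]; ring) h0
        (by rw [Units.val_one, mul_one, Int.toNat_of_nonneg (by omega)]; rw [abs_le]; constructor <;> omega)
      have hc0' : Φ.φ c₁ 0 - Φ.φ t 0 = (ℓ : ℤ) + 2 := by
        rw [hc0, Units.val_one, mul_one, Int.toNat_of_nonneg (by omega)]; omega
      obtain ⟨c, W₂, hlen₂, hd0, hd1, hsup₂⟩ := Φ.exists_ring_ray_one t c₁ ℓ 1 (2 * ℓ + 4)
        (by rw [hc0']; exact abs_of_nonneg (by positivity)) (by rw [hc1, hs, abs_of_nonpos (by omega)]; omega)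
        (by rw [hc1, Units.val_one, mul_one]; push_cast; rw [abs_le]; constructor <;> omega)
      refine ⟨c, W₁.append W₂, by rw [hd0]; exact hc0', ?_, ?_, fun u hu => ?_⟩
      · rw [hd1, hc1, Units.val_one, mul_one]; push_cast; omega
      · rw [Walk.length_append, hlen₁, hlen₂]; omega
      · rw [Walk.mem_support_append_iff] at hu
        rcases hu with hu | hu
        · exact hsup₁ u hu
        · exact hsup₂ u hu

end PlanarSkeletonFrm

end Summit.CriticalPhenomena.PercolationContinuityZ3.Theorems.Transplant

end
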